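import Summits.PneNP.PneNP.Theorems.OneSliceConstantBandDefs
import Summits.PneNP.PneNP.Theorems.OneSliceConstantBandRelMintermStepAux
import Summits.PneNP.PneNP.Theorems.OneSliceConstantBandTransferStepAux
import Literature.Computability.Complexity.RossmanMonotoneCliqueLemma23Proofs

/-!
# Route OneSlice, crux `ConstantBand` (stmt-PneNP-2834), line `flat-prior-relative-minterms`:
# the engine in distinguishing form — `AdvSparse ⟹ RelMintermSparse` and `AdvSparse ⟹ BandPair`

Two glue theorems around the line's load-bearing stub S4 (`RelMintermSparse`, open), recording in Lean the
reduction found by the lead and the drefuter (`Cruxes/ConstantBand/NegativeNote-drefute-flat-prior-relative-minterms.md`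
§S4):

* `fprm_relMintermSparse_of_advSparse : AdvSparse → RelMintermSparse` — for a MONOTONE `f`, on every slice the
  relative-minterm pairs `(x, A)` and the pairs with `f(x) = 1` are disjoint sub-events of `f(x ∪ K_A) = 1`, so the
  relative-minterm density is at most the planted-detection advantage (same witnesses `k, ρ, w₁`; no slack);
* `fprm_bandPair_of_advSparse : AdvSparse → BandPair` — if `C` rejects `≤ γ·#lower` of the planted pairs and has
  advantage `≤ ρ·#lower` on the lower band then it rejects `≤ (γ + ρ)·#lower + C(k,2) < #band/2` of the band, for
  `γ := (1/2 − ρ)/4` and `w ≥ C(k,2) + ⌈2·C(k,2)/(1/2 − ρ)⌉₊` (no contiguity and no flat prior are needed on this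
  path: `ConstantBand ⟸ TransferStep(S1, BandPair) ⟸ AdvSparse`).

So the crux reduces to `AdvSparse` through the landed stubs S1/S5 alone, and to `RelMintermSparse` through
S1/S2/S3/S5 (`bandPair_of` in the skeleton); `AdvSparse ⟹ RelMintermSparse`, and conversely the S2+S3 bookkeeping
bounds the advantage by the density up to `O(C(k,2)²/#lower) + o(1)` — the two forms of the engine are equivalent
up to slack. Both are open (an FPT average-case planted-`k`-clique distinguisher lower bound at the appearance
threshold); this file only fixes their logical relation. Decidability instances inside the unfolded counting
fractions are normalised with `Finset.filter_congr_decidable` before any explicit finset is written.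
-/

set_option linter.dupNamespace false

namespace Summit.PneNP.PneNP.Cruxes.ConstantBand.FlatPriorRelativeMinterms

open Literature.Computability.Complexity Filter Classical
open Finset hiding slice
open Summit.PneNP.PneNP.Theorems.ConstantBand.Negative

variable {n : ℕ}

/-! ## Density ≤ advantage (one slice, monotone `f`) -/

/-- On one slice, for a monotone `f`: `#{(x,A) : K_A rel. minterm of f at x} + #{x : f x = 1}·C(n,k) ≤
#{(x,A) : f(x ∪ K_A) = 1}` — the relative-minterm pairs and the pairs `(x, A)` with `f x = 1` are disjoint
sub-events of `f(x ∪ K_A) = 1`. (Decidability instances are implicit arguments, so that the lemma applies to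
the instances baked into the unfolded counting fractions.) -/
theorem fprm_card_relMinterm_add_le (k i : ℕ) {f : (Edge n → Bool) → Bool} (hf : Monotone f)
    {d₁ : DecidablePred fun xa : (Edge n → Bool) × Finset (Fin n) => IsRelMinterm f xa.1 xa.2}
    {d₂ : DecidablePred fun x : Edge n → Bool => f x = true}
    {d₃ : DecidablePred fun xa : (Edge n → Bool) × Finset (Fin n) => f (plantClique xa.2 xa.1) = true} :
    #(@Finset.filter _ (fun xa => IsRelMinterm f xa.1 xa.2) d₁
          (slice n i ×ˢ powersetCard k (univ : Finset (Fin n)))) +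
        #(@Finset.filter _ (fun x => f x = true) d₂ (slice n i)) * n.choose k ≤
      #(@Finset.filter _ (fun xa => f (plantClique xa.2 xa.1) = true) d₃
          (slice n i ×ˢ powersetCard k (univ : Finset (Fin n)))) := by
  have hT : #(powersetCard k (univ : Finset (Fin n))) = n.choose k := by
    rw [card_powersetCard, card_univ, Fintype.card_fin]
  have hdisj : Disjoint
      (@Finset.filter _ (fun xa => IsRelMinterm f xa.1 xa.2) d₁
        (slice n i ×ˢ powersetCard k (univ : Finset (Fin n))))
      ((@Finset.filter _ (fun x => f x = true) d₂ (slice n i)) ×ˢ powersetCard k (univ : Finset (Fin n))) := by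
    rw [Finset.disjoint_left]
    intro xa h1 h2
    rw [mem_filter] at h1
    rw [mem_product, mem_filter] at h2
    have h3 : f xa.1 = false := h1.2.1
    rw [h2.1.2] at h3
    exact Bool.false_ne_true h3.symm
  rw [← hT, ← card_product, ← card_union_of_disjoint hdisj]
  apply card_le_card
  intro xa hxa
  rw [mem_union] at hxa
  rw [mem_filter]
  rcases hxa with h | h
  · rw [mem_filter] at h
    exact ⟨h.1, h.2.2.1⟩
  · rw [mem_product, mem_filter] at h
    refine ⟨mem_product.2 ⟨h.1.1, h.2⟩, ?_⟩
    exact Bool.le_iff_imp.1 (hf (Rossman2010L23.le_plantClique xa.2 xa.1)) h.1.2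

/-- Fraction arithmetic behind "density ≤ advantage": `a + c·C ≤ b` over `ℕ` gives
`a/(E·C) ≤ b/(E·C) − c/E` over `ℝ` (`E, C > 0`). -/
theorem fprm_frac_le_of_count {a b c E C : ℕ} (hE : 0 < E) (hC : 0 < C) (h : a + c * C ≤ b) :
    (a : ℝ) / ((E : ℝ) * (C : ℝ)) ≤ (b : ℝ) / ((E : ℝ) * (C : ℝ)) - (c : ℝ) / (E : ℝ) := by
  have hEr : (0 : ℝ) < E := by exact_mod_cast hE
  have hCr : (0 : ℝ) < C := by exact_mod_cast hC
  have hD : (0 : ℝ) < (E : ℝ) * (C : ℝ) := mul_pos hEr hCr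
  have hcE : (c : ℝ) / (E : ℝ) = (c : ℝ) * (C : ℝ) / ((E : ℝ) * (C : ℝ)) := by
    rw [mul_div_mul_right _ _ hCr.ne']
  rw [hcE, ← sub_div, div_le_div_iff_of_pos_right hD, le_sub_iff_add_le]
  exact_mod_cast h

/-- **Density ≤ advantage** on one slice: for a monotone `f` and `0 < C(n,k)`,
`pairProb_i(IsRelMinterm f) ≤ pairProb_i(f(x ∪ K_A) = 1) − sliceProb_i(f = 1)`. -/
theorem fprm_pairProb_relMinterm_le_adv (k i : ℕ) {f : (Edge n → Bool) → Bool} (hf : Monotone f)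
    (hnk : 0 < n.choose k) :
    pairProb n k i (IsRelMinterm f) ≤
      pairProb n k i (fun x A => f (plantClique A x) = true) - sliceProb n i (fun x => f x = true) := by
  simp only [pairProb, sliceProb]
  by_cases hE : #(slice n i) = 0
  · have hsl : slice n i = ∅ := card_eq_zero.1 hE
    simp [hsl]
  · exact fprm_frac_le_of_count (Nat.pos_of_ne_zero hE) hnk (fprm_card_relMinterm_add_le k i hf)

/-- **`AdvSparse ⟹ RelMintermSparse`** (same witnesses `k, ρ, w₁`). -/
theorem fprm_relMintermSparse_of_advSparse : AdvSparse → RelMintermSparse := by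
  intro h c
  obtain ⟨k, hk, ρ, hρ, w₁, hA⟩ := h c
  refine ⟨k, hk, ρ, hρ, w₁, fun w hw => ?_⟩
  filter_upwards [hA w hw, eventually_ge_atTop k] with n hn hnk j hj C hC hs
  have hpos : 0 < n.choose k := Nat.choose_pos hnk
  refine le_trans (sum_le_sum fun i _ => ?_) (hn j hj C hC hs)
  exact fprm_pairProb_relMinterm_le_adv k i (C.monotone_eval_of_isOver_monotoneBasis hC) hpos

/-! ## `AdvSparse ⟹ BandPair` -/

/-- Counting fractions are at most `1`. -/
theorem fprm_sliceProb_le_one (i : ℕ) (P : (Edge n → Bool) → Prop) : sliceProb n i P ≤ 1 := by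
  simp only [sliceProb]
  by_cases hS : (#(slice n i) : ℝ) = 0
  · rw [hS, div_zero]
    exact zero_le_one
  · rw [div_le_one (lt_of_le_of_ne (Nat.cast_nonneg _) (Ne.symm hS))]
    exact_mod_cast card_filter_le _ _

/-- Complement rule for a Boolean event `g` on a finset, as fractions with a common denominator `D = #s ≠ 0`
(decidability instances implicit, as above). -/
theorem fprm_frac_false_add_true {α : Type*} (s : Finset α) (g : α → Bool)
    {d₁ : DecidablePred fun x : α => g x = false} {d₂ : DecidablePred fun x : α => g x = true}
    {D : ℝ} (hD : D ≠ 0) (hs : (#s : ℝ) = D) :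
    (#(@Finset.filter _ (fun x => g x = false) d₁ s) : ℝ) / D +
      (#(@Finset.filter _ (fun x => g x = true) d₂ s) : ℝ) / D = 1 := by
  rw [← add_div, div_eq_one_iff_eq hD, ← hs]
  have hdisj : Disjoint (@Finset.filter _ (fun x => g x = false) d₁ s)
      (@Finset.filter _ (fun x => g x = true) d₂ s) :=
    disjoint_filter.2 fun x _ h1 h2 => by rw [h1] at h2; exact Bool.false_ne_true h2
  have hunion : (@Finset.filter _ (fun x => g x = false) d₁ s) ∪
      (@Finset.filter _ (fun x => g x = true) d₂ s) = s := by
    ext x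
    simp only [mem_union, mem_filter]
    cases g x <;> simp
  rw [← Nat.cast_add, ← card_union_of_disjoint hdisj, hunion]

/-- Complement rule on a non-empty slice: `sliceProb_i(f = 0) + sliceProb_i(f = 1) = 1`. -/
theorem fprm_sliceProb_false_add_true (i : ℕ) (f : (Edge n → Bool) → Bool) (hS : (#(slice n i) : ℝ) ≠ 0) :
    sliceProb n i (fun x => f x = false) + sliceProb n i (fun x => f x = true) = 1 := by
  simp only [sliceProb]
  exact fprm_frac_false_add_true (slice n i) f hS rfl

/-- Complement rule for the planted-pair fraction on a non-degenerate slice: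
`pairProb_i(f(x ∪ K_A) = 0) + pairProb_i(f(x ∪ K_A) = 1) = 1` when `#slice_i · C(n,k) ≠ 0`. -/
theorem fprm_pairProb_false_add_true (k i : ℕ) (f : (Edge n → Bool) → Bool)
    (hD : (#(slice n i) : ℝ) * (n.choose k : ℝ) ≠ 0) :
    pairProb n k i (fun x A => f (plantClique A x) = false) +
      pairProb n k i (fun x A => f (plantClique A x) = true) = 1 := by
  simp only [pairProb]
  have hs : (#(slice n i ×ˢ powersetCard k (univ : Finset (Fin n))) : ℝ) =
      (#(slice n i) : ℝ) * (n.choose k : ℝ) := by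
    rw [card_product, card_powersetCard, card_univ, Fintype.card_fin, Nat.cast_mul]
  exact fprm_frac_false_add_true (slice n i ×ˢ powersetCard k (univ : Finset (Fin n)))
    (fun xa => f (plantClique xa.2 xa.1)) hD hs

/-- **`AdvSparse ⟹ BandPair`**: with `γ := (1/2 − ρ)/4` and `w := max w₁ (C(k,2) + ⌈2·C(k,2)/(1/2 − ρ)⌉₊)`,
a small monotone circuit rejecting `≤ γ·#lower` of the planted pairs and with lower-band advantage `≤ ρ·#lower`
rejects at most `(γ + ρ)·#lower + C(k,2) < #lower/2 ≤ #band/2` of the band. -/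
theorem fprm_bandPair_of_advSparse : AdvSparse → BandPair := by
  intro h c
  obtain ⟨k, hk, ρ, hρ, w₁, hA⟩ := h c
  have hhalf : 0 < 1 / 2 - ρ := by linarith
  have hγ0 : 0 < (1 / 2 - ρ) / 4 := by linarith
  refine ⟨k, hk, max w₁ (k.choose 2 + ⌈2 * (k.choose 2 : ℝ) / (1 / 2 - ρ)⌉₊), (1 / 2 - ρ) / 4, hγ0, ?_⟩
  have hw₁ : w₁ ≤ max w₁ (k.choose 2 + ⌈2 * (k.choose 2 : ℝ) / (1 / 2 - ρ)⌉₊) := le_max_left _ _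
  filter_upwards [hA _ hw₁, ts_eventually_window k hk (max w₁ (k.choose 2 + ⌈2 * (k.choose 2 : ℝ) / (1 / 2 - ρ)⌉₊)),
    eventually_ge_atTop k] with n hAn hWn hnk
  intro j hj C hC hs hplanted
  -- names for the width, the bands and `K = C(k,2)`
  generalize hw : max w₁ (k.choose 2 + ⌈2 * (k.choose 2 : ℝ) / (1 / 2 - ρ)⌉₊) = w at hAn hWn hplanted ⊢
  have hwK : k.choose 2 + ⌈2 * (k.choose 2 : ℝ) / (1 / 2 - ρ)⌉₊ ≤ w := by rw [← hw]; exact le_max_right _ _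
  obtain ⟨_, hWj⟩ := hWn
  obtain ⟨_, hWi⟩ := hWj j hj
  have hKpos : (0 : ℝ) < n.choose k := by exact_mod_cast Nat.choose_pos hnk
  have hadv := hAn j hj C hC hs
  have hIdef : lowerBand k j w = Icc (j - w) (j + w - k.choose 2) := rfl
  have hBdef : band j w = Icc (j - w) (j + w) := rfl
  -- every lower slice is non-empty, so the complement rules apply there
  have hslice : ∀ i ∈ lowerBand k j w, (#(slice n i) : ℝ) ≠ 0 := by
    intro i hi
    rw [hIdef, mem_Icc] at hi
    have hi' : i ≤ j + w := by omega
    have hpos := ts_card_slice_pos (n := n) (hWi i hi').1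
    have : (0 : ℝ) < #(slice n i) := by exact_mod_cast hpos
    exact this.ne'
  have hkey : ∀ i ∈ lowerBand k j w, sliceProb n i (fun x => C.eval x = false) =
      pairProb n k i (fun x A => C.eval (plantClique A x) = false) +
        (pairProb n k i (fun x A => C.eval (plantClique A x) = true) -
          sliceProb n i (fun x => C.eval x = true)) := by
    intro i hi
    have h1 := fprm_sliceProb_false_add_true i C.eval (hslice i hi)
    have h2 := fprm_pairProb_false_add_true k i C.eval (mul_ne_zero (hslice i hi) hKpos.ne')
    linarith
  -- the lower-band rejection is at most `(γ + ρ)·#lower`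
  have hlow : ∑ i ∈ lowerBand k j w, sliceProb n i (fun x => C.eval x = false) ≤
      ((1 / 2 - ρ) / 4 + ρ) * #(lowerBand k j w) := by
    calc ∑ i ∈ lowerBand k j w, sliceProb n i (fun x => C.eval x = false)
        = ∑ i ∈ lowerBand k j w, (pairProb n k i (fun x A => C.eval (plantClique A x) = false) +
            (pairProb n k i (fun x A => C.eval (plantClique A x) = true) -
              sliceProb n i (fun x => C.eval x = true))) := sum_congr rfl hkey
      _ = ∑ i ∈ lowerBand k j w, pairProb n k i (fun x A => C.eval (plantClique A x) = false) +
            ∑ i ∈ lowerBand k j w, (pairProb n k i (fun x A => C.eval (plantClique A x) = true) -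
              sliceProb n i (fun x => C.eval x = true)) := sum_add_distrib
      _ ≤ (1 / 2 - ρ) / 4 * #(lowerBand k j w) + ρ * #(lowerBand k j w) := add_le_add hplanted hadv
      _ = ((1 / 2 - ρ) / 4 + ρ) * #(lowerBand k j w) := by ring
  -- the band rejection exceeds the lower-band rejection by at most `K`
  have hIB : lowerBand k j w ⊆ band j w := rms_Icc_lower_subset (k.choose 2) j w
  have hsplit : ∑ i ∈ band j w, sliceProb n i (fun x => C.eval x = false) ≤
      ∑ i ∈ lowerBand k j w, sliceProb n i (fun x => C.eval x = false) + k.choose 2 := by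
    have hsd := sum_sdiff hIB (f := fun i => sliceProb n i (fun x => C.eval x = false))
    have hbd : ∑ i ∈ band j w \ lowerBand k j w, sliceProb n i (fun x => C.eval x = false) ≤ k.choose 2 :=
      calc ∑ i ∈ band j w \ lowerBand k j w, sliceProb n i (fun x => C.eval x = false)
          ≤ ∑ _i ∈ band j w \ lowerBand k j w, (1 : ℝ) := sum_le_sum fun i _ => fprm_sliceProb_le_one i _
        _ = #(band j w \ lowerBand k j w) := by rw [sum_const, nsmul_eq_mul, mul_one]
        _ ≤ k.choose 2 := by
            have h := rms_card_Icc_sdiff_le (k.choose 2) j w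
            rw [← hIdef, ← hBdef] at h
            exact_mod_cast h
    linarith
  -- sizes of the bands
  have hcardIB : (#(lowerBand k j w) : ℝ) ≤ #(band j w) := by exact_mod_cast card_le_card hIB
  have hcardI : (w : ℝ) + 1 - k.choose 2 ≤ #(lowerBand k j w) := by
    have h := rms_card_Icc_lower_ge (k.choose 2) j w
    rw [← hIdef] at h
    have hwK' : k.choose 2 ≤ w + 1 := by omega
    have h' : ((w + 1 - k.choose 2 : ℕ) : ℝ) ≤ #(lowerBand k j w) := by exact_mod_cast h
    rw [Nat.cast_sub hwK', Nat.cast_add, Nat.cast_one] at h'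
    exact h'
  have hceil : 2 * (k.choose 2 : ℝ) / (1 / 2 - ρ) ≤ (⌈2 * (k.choose 2 : ℝ) / (1 / 2 - ρ)⌉₊ : ℝ) :=
    Nat.le_ceil _
  have hwge : (k.choose 2 : ℝ) + (⌈2 * (k.choose 2 : ℝ) / (1 / 2 - ρ)⌉₊ : ℝ) ≤ w := by exact_mod_cast hwK
  have hI_big : 2 * (k.choose 2 : ℝ) / (1 / 2 - ρ) ≤ #(lowerBand k j w) - 1 := by linarith
  have h5 : 2 * (k.choose 2 : ℝ) ≤ (#(lowerBand k j w) - 1) * (1 / 2 - ρ) := (div_le_iff₀ hhalf).1 hI_big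
  have hK0 : (0 : ℝ) ≤ k.choose 2 := Nat.cast_nonneg _
  -- `(γ + ρ)·#I + K < #I / 2 ≤ #B / 2`
  have hfinal : ((1 / 2 - ρ) / 4 + ρ) * #(lowerBand k j w) + k.choose 2 <
      (1 / 2 : ℝ) * #(lowerBand k j w) := by
    nlinarith [h5, hhalf, hK0]
  calc ∑ i ∈ band j w, sliceProb n i (fun x => C.eval x = false)
      ≤ ∑ i ∈ lowerBand k j w, sliceProb n i (fun x => C.eval x = false) + k.choose 2 := hsplit
    _ ≤ ((1 / 2 - ρ) / 4 + ρ) * #(lowerBand k j w) + k.choose 2 := add_le_add hlow le_rfl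
    _ < (1 / 2 : ℝ) * #(lowerBand k j w) := hfinal
    _ ≤ (1 / 2 : ℝ) * #(band j w) := mul_le_mul_of_nonneg_left hcardIB (by norm_num)

end Summit.PneNP.PneNP.Cruxes.ConstantBand.FlatPriorRelativeMinterms
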